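import Summits.ResolutionOfSingularities.ResolutionOfSingularities.Theorems.HomologicalConductorNoZenoCapture
import Literature.AlgebraicGeometry.Resolution.QuadraticTransforms
import HarnessLib

/-!
# Crux `NoZeno` / `NoZenoR` (stmt-ResolutionOfSingularities-16483 / -19943), line `sandwich-cluster`,
# S2 `stub_regularOfBasePtsEmpty`, feeder for steps (a)/(b): members of a chain of local blowing
# ups are essentially of finite type over the base, in elementary form

Route `ResolutionOfSingularities/HomologicalConductor`.  OURS (cell res-hironaka); nothing here is a
statement of the manuscript under review.  The ZMT dichotomy of `…ZMTDichotomy.lean` takes the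
finiteness of `S` over `T` in the elementary form «every element of `S` is `y * z⁻¹` with
`y, z ∈ k[T ∪ g]` for a finite `g ⊆ S` and `z⁻¹ ∈ S`».  This file proves that every member `S_n`
of a chain of LOCAL BLOWING UPS along a valuation ring `O` (`IsLocalBlowup`,
`Literature/…/LocalBlowup.lean`; in particular the quadratic sequence of `R` along `O`,
`IsQuadraticTransformAlong.isLocalBlowup`) starting at a `k`-subalgebra `R` has this property over
`R` (hence over any `T` with `R ≤ T ≤ S_n`):

* `exists_frac_of_mem_closure` — elements of the subring generated by `S_n ∪ t` are such fractions
  once the elements of `S_n` are;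
* `exists_finset_frac_of_isLocalBlowup_chain` — the induction along the chain.

References: J. Novacoski, M. Spivakovsky, Def. 2.8 / Lemma 2.9 [`NovacoskiSpivakovsky2014`]
(local blowing ups compose); S. Abhyankar 1956 (quadratic sequences) [`Abhyankar1956Valuations`].
-/

noncomputable section

-- single-problem summit: the doubled namespace component `ResolutionOfSingularities` is forced
set_option linter.dupNamespace false

namespace Summit.ResolutionOfSingularities.ResolutionOfSingularities.Theorems.NoZeno.SandwichCluster

open Literature.AlgebraicGeometry.Resolution

variable {k K : Type} [Field k] [Field K] [Algebra k K]

/-- **Fractions propagate through ring generation.**  If every element of the subring `B ⊆ K` is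
`y * z⁻¹` with `y, z` in the `k`-subalgebra `C` and `z⁻¹ ∈ B`, and `t ⊆ C` is a further set, then
every element of the subring generated by `B ∪ t` is `y * z⁻¹` with `y, z ∈ C` and `z⁻¹ ∈ B`
(common denominators; `z` runs over products of the given denominators). [folklore] -/
theorem exists_frac_of_mem_closure (B : Subring K) (C : Subalgebra k K) (t : Set K) (htC : t ⊆ C)
    (hB : ∀ b ∈ B, ∃ y ∈ C, ∃ z ∈ C, z⁻¹ ∈ B ∧ z ≠ 0 ∧ b = y * z⁻¹) {c : K}
    (hc : c ∈ Subring.closure ((B : Set K) ∪ t)) :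
    ∃ y ∈ C, ∃ z ∈ C, z⁻¹ ∈ B ∧ z ≠ 0 ∧ c = y * z⁻¹ := by
  induction hc using Subring.closure_induction with
  | mem x hx =>
    rcases hx with hx | hx
    · exact hB x hx
    · exact ⟨x, htC hx, 1, C.one_mem, by rw [inv_one]; exact B.one_mem, one_ne_zero, by simp⟩
  | zero => exact ⟨0, C.zero_mem, 1, C.one_mem, by rw [inv_one]; exact B.one_mem, one_ne_zero, by simp⟩
  | one => exact ⟨1, C.one_mem, 1, C.one_mem, by rw [inv_one]; exact B.one_mem, one_ne_zero, by simp⟩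
  | add x y _ _ hx hy =>
    obtain ⟨y₁, hy₁, z₁, hz₁, hz₁B, hz₁0, rfl⟩ := hx
    obtain ⟨y₂, hy₂, z₂, hz₂, hz₂B, hz₂0, rfl⟩ := hy
    refine ⟨y₁ * z₂ + y₂ * z₁, C.add_mem (C.mul_mem hy₁ hz₂) (C.mul_mem hy₂ hz₁), z₁ * z₂,
      C.mul_mem hz₁ hz₂, ?_, mul_ne_zero hz₁0 hz₂0, ?_⟩
    · rw [mul_inv]; exact B.mul_mem hz₁B hz₂B
    · field_simp
  | neg x _ hx =>
    obtain ⟨y₁, hy₁, z₁, hz₁, hz₁B, hz₁0, rfl⟩ := hx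
    exact ⟨-y₁, C.neg_mem hy₁, z₁, hz₁, hz₁B, hz₁0, by rw [neg_mul]⟩
  | mul x y _ _ hx hy =>
    obtain ⟨y₁, hy₁, z₁, hz₁, hz₁B, hz₁0, rfl⟩ := hx
    obtain ⟨y₂, hy₂, z₂, hz₂, hz₂B, hz₂0, rfl⟩ := hy
    refine ⟨y₁ * y₂, C.mul_mem hy₁ hy₂, z₁ * z₂, C.mul_mem hz₁ hz₂, ?_, mul_ne_zero hz₁0 hz₂0, ?_⟩
    · rw [mul_inv]; exact B.mul_mem hz₁B hz₂B
    · rw [mul_inv]; ring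

/-- **Members of a chain of local blowing ups are essentially of finite type over the base, in
elementary form.**  Let `S₀ = R` (a `k`-subalgebra of `K`) and `S_(i+1)` a local blowing up of `S_i`
along `O` for every `i` (e.g. the quadratic sequence of `R` along `O`).  Then for every `n` there is
a finite `g ⊆ S_n` such that every element of `S_n` is `y * z⁻¹` with `y, z ∈ k[R ∪ g]`, `z ≠ 0`
and `z⁻¹ ∈ S_n`. [cite: NovacoskiSpivakovsky2014, Lemma 2.9] -/
theorem exists_finset_frac_of_isLocalBlowup_chain (O : ValuationSubring K) (R : Subalgebra k K)
    (seq : ℕ → Subring K) (h0 : seq 0 = R.toSubring)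
    (hstep : ∀ i, IsLocalBlowup O (seq i) (seq (i + 1))) (n : ℕ) :
    ∃ g : Finset K, (↑g : Set K) ⊆ seq n ∧
      ∀ s ∈ seq n, ∃ y ∈ Algebra.adjoin k ((R : Set K) ∪ ↑g),
        ∃ z ∈ Algebra.adjoin k ((R : Set K) ∪ ↑g), z⁻¹ ∈ seq n ∧ z ≠ 0 ∧ s = y * z⁻¹ := by
  classical
  induction n with
  | zero =>
    refine ⟨∅, by simp, fun s hs => ?_⟩
    rw [h0] at hs ⊢
    refine ⟨s, Algebra.subset_adjoin (Or.inl hs), 1, Subalgebra.one_mem _, ?_, one_ne_zero, by simp⟩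
    rw [inv_one]; exact R.one_mem
  | succ n ih =>
    obtain ⟨g, hg, hfrac⟩ := ih
    obtain ⟨hBO, t, htO, heq⟩ := hstep n
    have hle : seq n ≤ seq (n + 1) := (hstep n).le
    -- new generators: the old ones and `t`
    refine ⟨g ∪ t, ?_, fun s hs => ?_⟩
    · rw [Finset.coe_union]
      refine Set.union_subset (hg.trans hle) ?_
      rw [heq]
      exact (Subring.subset_closure.trans' Set.subset_union_right).trans (le_locAtCentre _ O)
    set C : Subalgebra k K := Algebra.adjoin k ((R : Set K) ∪ ↑(g ∪ t)) with hC
    have hCmono : Algebra.adjoin k ((R : Set K) ∪ ↑g) ≤ C := by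
      refine Algebra.adjoin_mono (Set.union_subset_union_right _ ?_)
      rw [Finset.coe_union]; exact Set.subset_union_left
    have htC : (↑t : Set K) ⊆ C := fun x hx =>
      Algebra.subset_adjoin (Or.inr (by rw [Finset.coe_union]; exact Or.inr hx))
    -- every element of `closure (seq n ∪ t)` is a fraction over `C` with denominator inverted in `seq n`
    have hB : ∀ b ∈ seq n, ∃ y ∈ C, ∃ z ∈ C, z⁻¹ ∈ seq n ∧ z ≠ 0 ∧ b = y * z⁻¹ := by
      intro b hb
      obtain ⟨y, hy, z, hz, hzinv, hz0, rfl⟩ := hfrac b hb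
      exact ⟨y, hCmono hy, z, hCmono hz, hzinv, hz0, rfl⟩
    rw [heq, mem_locAtCentre_iff] at hs
    obtain ⟨y, hy, z, hz, hvz, rfl⟩ := hs
    obtain ⟨Y₁, hY₁, Z₁, hZ₁, hZ₁B, hZ₁0, rfl⟩ := exists_frac_of_mem_closure (seq n) C ↑t htC hB hy
    obtain ⟨Y₂, hY₂, Z₂, hZ₂, hZ₂B, hZ₂0, hzeq⟩ := exists_frac_of_mem_closure (seq n) C ↑t htC hB hz
    have hz0 : z ≠ 0 := ne_zero_of_valuation_eq_one hvz
    have hY₂0 : Y₂ ≠ 0 := by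
      intro h; apply hz0; rw [hzeq, h, zero_mul]
    -- the inverse of the denominator `z` lies in `seq (n+1)`
    have hzinv : z⁻¹ ∈ seq (n + 1) := by
      rw [heq]
      exact inv_mem_locAtCentre (le_locAtCentre _ O hz) hvz
    refine ⟨Y₁ * Z₂, C.mul_mem hY₁ hZ₂, Z₁ * Y₂, C.mul_mem hZ₁ hY₂, ?_, mul_ne_zero hZ₁0 hY₂0, ?_⟩
    · -- `(Z₁ Y₂)⁻¹ = Z₁⁻¹ * (z⁻¹ * Z₂⁻¹)` since `Y₂ = z * Z₂`
      have hY₂inv : Y₂⁻¹ = z⁻¹ * Z₂⁻¹ := by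
        rw [hzeq, mul_inv, inv_inv, mul_assoc, mul_inv_cancel₀ hZ₂0, mul_one]
      rw [mul_inv, hY₂inv]
      exact (seq (n + 1)).mul_mem (hle hZ₁B) ((seq (n + 1)).mul_mem hzinv (hle hZ₂B))
    · rw [hzeq]; field_simp

end Summit.ResolutionOfSingularities.ResolutionOfSingularities.Theorems.NoZeno.SandwichCluster

end
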